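import Summits.CriticalPhenomena.PercolationContinuityZ3.Theorems.PercNearOneGluingNoHeavyLowerTailPathExchange
import Literature.Probability.Percolation.KozmaNitzanPreFKG
import HarnessLib

/-!
# `NoHeavyLowerTail` (stmt-CriticalPhenomena-4575) — "OWN DISCONNECTION HURTS MOST": the ratio form of
# Kozma–Nitzan's Lemma 3(ii), and the diamond inequality

Support file (prover prim-gen-kcluster gen 2; `--supports stmt-CriticalPhenomena-4575`).  No definitions, no sorries.

For bond percolation with arbitrary edge probabilities on a finite vertex type, vertices `o, x, y, b`:

* `diamond` (PROVED, new):  `μ({o↔x}∩{y↔b}∩{x↮b}) · μ({x↔b}∩{y↮b}) ≤ μ({o↔x}∩{x↔b}∩{y↮b}) · μ({y↔b}∩{x↮b})`,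
  i.e. `μ(o↔x | x↮b, y↔b) ≤ μ(o↔x | x↔b, y↮b)`: given that exactly one of `x, y` is joined to `b`, joining `o`
  to `x` prefers `x` to be the one.  Proof: on the partition lattice of `{o,x,y,b}` it reads
  `V (R + V' + m°_x) ≤ R (V + R' + m°_y)`, the sum of the tripod exchange `V V' ≤ R R'` (`tripodExchange`) and the
  path exchange `V m°_x ≤ R m°_y` (`pathExchange`).
* `ownDisconnection_le` (PROVED, new):  if `μ(y↮b) ≤ μ(x↮b)` (`x` is the worse relay) then
  `μ({o↔x}∩{x↮b}) · μ(y↮b) ≤ μ({o↔x}∩{y↮b}) · μ(x↮b)`, i.e. **`μ(o↔x | x↮b) ≤ μ(o↔x | y↮b)`**: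
  conditioning on the worse relay's OWN disconnection from the sink lowers its connection to the observer at
  least as much as conditioning on the better relay's disconnection.  Kozma–Nitzan's Lemma 3(ii)
  (arXiv:2401.12397 p. 6, with `Q = {o↮x}`, `δ = 0`) gives only `μ(o↮x, y↮b) ≤ μ(o↮x, x↮b)`; the ratio form
  divides by `μ(y↮b) ≤ μ(x↮b)`.  Proof: with `D = {x↮b}`, `F = {y↔b}∩D`, `G = {x↔b}∩{y↮b}`, `Q = {o↔x}` the claim is
  `μ(D)μ(QF) − μ(QD)μ(F) ≤ μ(D)μ(QG) − μ(QD)μ(G)`; the left side is `≤ 0` by BHK 2006 Thm 1.4 (`C_b` vs `C_x` on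
  `{b↮x}`), and when the right side is negative the `diamond` and `μ(G) ≤ μ(F)` finish.
* `ownDisconnection_compl`: the same in the form `μ({o↮x}∩{y↮b}) · μ(x↮b) ≤ μ({o↮x}∩{x↮b}) · μ(y↮b)`.
This is the two-relay case (M₂) of the "cumulative monotonicity" chain behind worst-first gluing
(`Theorems.eventGluing_of_worstFirst`); it implies `Theorems.worstFirst_two_mul`.
-/

noncomputable section

namespace Summit.CriticalPhenomena.PercolationContinuityZ3.Theorems

open MeasureTheory Set Literature.Probability.LatticeModels Literature.Probability.Percolation
open scoped Classical

namespace OwnDisconnection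

variable {V : Type*}

/-- `μ(E ∩ F) + μ(E ∩ Fᶜ) = μ(E)`. [folklore] -/
theorem split [Fintype V] (w : Sym2 V → unitInterval) (E F : Set (BondConfig V)) :
    (prodBernoulli w).real (E ∩ F) + (prodBernoulli w).real (E ∩ Fᶜ) = (prodBernoulli w).real E := by
  rw [← Set.sdiff_eq]
  exact measureReal_inter_add_sdiff MeasurableSet.of_discrete

/-- Three-way split of an event by the status of `o`: `o↔x`, or `o↮x ∧ o↔y`, or `o↮x ∧ o↮y`. [folklore] -/
theorem split₃ [Fintype V] (w : Sym2 V → unitInterval) (E : Set (BondConfig V)) (o x y : V) :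
    (prodBernoulli w).real E = (prodBernoulli w).real (E ∩ openConn o x) +
      (prodBernoulli w).real (E ∩ (openConn o x)ᶜ ∩ openConn o y) +
        (prodBernoulli w).real (E ∩ (openConn o x)ᶜ ∩ (openConn o y)ᶜ) := by
  have h1 := split w E (openConn o x)
  have h2 := split w (E ∩ (openConn o x)ᶜ) (openConn o y)
  linarith

end OwnDisconnection

open OwnDisconnection

variable {V : Type*}

/-- **The diamond inequality (PROVED).**  `μ({o↔x}∩{y↔b}∩{x↮b}) · μ({x↔b}∩{y↮b}) ≤ μ({o↔x}∩{x↔b}∩{y↮b}) · μ({y↔b}∩{x↮b})`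
— tripod exchange plus path exchange on the partition lattice of `{o, x, y, b}`. [this file] -/
theorem diamond [Fintype V] (w : Sym2 V → unitInterval) (o x y b : V) :
    (prodBernoulli w).real (openConn o x ∩ openConn y b ∩ (openConn x b)ᶜ) *
        (prodBernoulli w).real (openConn x b ∩ (openConn y b)ᶜ) ≤
      (prodBernoulli w).real (openConn o x ∩ openConn x b ∩ (openConn y b)ᶜ) *
        (prodBernoulli w).real (openConn y b ∩ (openConn x b)ᶜ) := by
  set μ := prodBernoulli w with hμ
  have hT := tripodExchange w o x y b
  have hP := pathExchange w o x y b
  -- the cells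
  set Vv := μ.real (openConn o x ∩ openConn y b ∩ (openConn x y)ᶜ) with hVv
  set V' := μ.real (openConn o y ∩ openConn x b ∩ (openConn x y)ᶜ) with hV'
  set Rr := μ.real (openConn o x ∩ openConn x b ∩ (openConn x y)ᶜ) with hRr
  set R' := μ.real (openConn o y ∩ openConn y b ∩ (openConn x y)ᶜ) with hR'
  set Mx := μ.real (openConn x b ∩ (openConn o x)ᶜ ∩ (openConn o y)ᶜ ∩ (openConn x y)ᶜ) with hMx
  set My := μ.real (openConn y b ∩ (openConn o x)ᶜ ∩ (openConn o y)ᶜ ∩ (openConn x y)ᶜ) with hMy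
  -- identify the four events of the statement
  have eV : (openConn o x ∩ openConn y b ∩ (openConn x b)ᶜ : Set (BondConfig V)) =
      openConn o x ∩ openConn y b ∩ (openConn x y)ᶜ := by
    ext ω; simp only [mem_inter_iff, mem_compl_iff, openConn, mem_setOf_eq]
    constructor
    · rintro ⟨⟨hox, hyb⟩, hxb⟩; exact ⟨⟨hox, hyb⟩, fun hxy => hxb (hxy.trans hyb)⟩
    · rintro ⟨⟨hox, hyb⟩, hxy⟩; exact ⟨⟨hox, hyb⟩, fun hxb => hxy (hxb.trans (PathExchange.rs hyb))⟩
  have eR : (openConn o x ∩ openConn x b ∩ (openConn y b)ᶜ : Set (BondConfig V)) =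
      openConn o x ∩ openConn x b ∩ (openConn x y)ᶜ := by
    ext ω; simp only [mem_inter_iff, mem_compl_iff, openConn, mem_setOf_eq]
    constructor
    · rintro ⟨⟨hox, hxb⟩, hyb⟩; exact ⟨⟨hox, hxb⟩, fun hxy => hyb ((PathExchange.rs hxy).trans hxb)⟩
    · rintro ⟨⟨hox, hxb⟩, hxy⟩; exact ⟨⟨hox, hxb⟩, fun hyb => hxy (hxb.trans (PathExchange.rs hyb))⟩
  -- μ(G) = R + V' + Mx,  G = {x↔b} ∩ {y↮b}
  have eG : μ.real (openConn x b ∩ (openConn y b)ᶜ) = Rr + V' + Mx := by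
    rw [split₃ w (openConn x b ∩ (openConn y b)ᶜ) o x y]
    have a1 : (openConn x b ∩ (openConn y b)ᶜ ∩ openConn o x : Set (BondConfig V)) =
        openConn o x ∩ openConn x b ∩ (openConn x y)ᶜ := by
      rw [← eR]; ext ω; simp only [mem_inter_iff, mem_compl_iff]; tauto
    have a2 : (openConn x b ∩ (openConn y b)ᶜ ∩ (openConn o x)ᶜ ∩ openConn o y : Set (BondConfig V)) =
        openConn o y ∩ openConn x b ∩ (openConn x y)ᶜ := by
      ext ω; simp only [mem_inter_iff, mem_compl_iff, openConn, mem_setOf_eq]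
      constructor
      · rintro ⟨⟨⟨hxb, hyb⟩, _⟩, hoy⟩; exact ⟨⟨hoy, hxb⟩, fun hxy => hyb ((PathExchange.rs hxy).trans hxb)⟩
      · rintro ⟨⟨hoy, hxb⟩, hxy⟩
        exact ⟨⟨⟨hxb, fun hyb => hxy (hxb.trans (PathExchange.rs hyb))⟩, fun hox => hxy ((PathExchange.rs hox).trans hoy)⟩, hoy⟩
    have a3 : (openConn x b ∩ (openConn y b)ᶜ ∩ (openConn o x)ᶜ ∩ (openConn o y)ᶜ : Set (BondConfig V)) =
        openConn x b ∩ (openConn o x)ᶜ ∩ (openConn o y)ᶜ ∩ (openConn x y)ᶜ := by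
      ext ω; simp only [mem_inter_iff, mem_compl_iff, openConn, mem_setOf_eq]
      constructor
      · rintro ⟨⟨⟨hxb, hyb⟩, hox⟩, hoy⟩; exact ⟨⟨⟨hxb, hox⟩, hoy⟩, fun hxy => hyb ((PathExchange.rs hxy).trans hxb)⟩
      · rintro ⟨⟨⟨hxb, hox⟩, hoy⟩, hxy⟩; exact ⟨⟨⟨hxb, fun hyb => hxy (hxb.trans (PathExchange.rs hyb))⟩, hox⟩, hoy⟩
    rw [a1, a2, a3]
  -- μ(F) = V + R' + My,  F = {y↔b} ∩ {x↮b}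
  have eF : μ.real (openConn y b ∩ (openConn x b)ᶜ) = Vv + R' + My := by
    rw [split₃ w (openConn y b ∩ (openConn x b)ᶜ) o x y]
    have a1 : (openConn y b ∩ (openConn x b)ᶜ ∩ openConn o x : Set (BondConfig V)) =
        openConn o x ∩ openConn y b ∩ (openConn x y)ᶜ := by
      rw [← eV]; ext ω; simp only [mem_inter_iff, mem_compl_iff]; tauto
    have a2 : (openConn y b ∩ (openConn x b)ᶜ ∩ (openConn o x)ᶜ ∩ openConn o y : Set (BondConfig V)) =
        openConn o y ∩ openConn y b ∩ (openConn x y)ᶜ := by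
      ext ω; simp only [mem_inter_iff, mem_compl_iff, openConn, mem_setOf_eq]
      constructor
      · rintro ⟨⟨⟨hyb, hxb⟩, _⟩, hoy⟩; exact ⟨⟨hoy, hyb⟩, fun hxy => hxb (hxy.trans hyb)⟩
      · rintro ⟨⟨hoy, hyb⟩, hxy⟩
        exact ⟨⟨⟨hyb, fun hxb => hxy (hxb.trans (PathExchange.rs hyb))⟩, fun hox => hxy ((PathExchange.rs hox).trans (hoy.trans
          (hyb.trans (PathExchange.rs hyb))))⟩, hoy⟩
    have a3 : (openConn y b ∩ (openConn x b)ᶜ ∩ (openConn o x)ᶜ ∩ (openConn o y)ᶜ : Set (BondConfig V)) =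
        openConn y b ∩ (openConn o x)ᶜ ∩ (openConn o y)ᶜ ∩ (openConn x y)ᶜ := by
      ext ω; simp only [mem_inter_iff, mem_compl_iff, openConn, mem_setOf_eq]
      constructor
      · rintro ⟨⟨⟨hyb, hxb⟩, hox⟩, hoy⟩; exact ⟨⟨⟨hyb, hox⟩, hoy⟩, fun hxy => hxb (hxy.trans hyb)⟩
      · rintro ⟨⟨⟨hyb, hox⟩, hoy⟩, hxy⟩; exact ⟨⟨⟨hyb, fun hxb => hxy (hxb.trans (PathExchange.rs hyb))⟩, hox⟩, hoy⟩
    rw [a1, a2, a3]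
  rw [eV, eR, eG, eF]
  have h0 : 0 ≤ Vv := measureReal_nonneg
  have h1 : 0 ≤ Rr := measureReal_nonneg
  nlinarith [hT, hP, mul_nonneg h0 h1]

/-- **Own disconnection hurts most — the ratio form of Kozma–Nitzan's Lemma 3(ii) (PROVED).**
If `μ(y ↮ b) ≤ μ(x ↮ b)` then `μ({o↔x}∩{x↮b}) · μ(y↮b) ≤ μ({o↔x}∩{y↮b}) · μ(x↮b)`, i.e.
`μ(o ↔ x | x ↮ b) ≤ μ(o ↔ x | y ↮ b)`.
[cite: KozmaNitzan2024, Lemma 3(ii) (p. 6) — strengthened (ratio form), derived in this file from BHK 2006 Thm 1.4 and `diamond`] -/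
theorem ownDisconnection_le [Fintype V] (w : Sym2 V → unitInterval) (o x y b : V)
    (hd : (prodBernoulli w).real (openConn y b : Set (BondConfig V))ᶜ ≤
      (prodBernoulli w).real (openConn x b : Set (BondConfig V))ᶜ) :
    (prodBernoulli w).real (openConn o x ∩ (openConn x b)ᶜ) *
        (prodBernoulli w).real (openConn y b : Set (BondConfig V))ᶜ ≤
      (prodBernoulli w).real (openConn o x ∩ (openConn y b)ᶜ) *
        (prodBernoulli w).real (openConn x b : Set (BondConfig V))ᶜ := by
  set μ := prodBernoulli w with hμ
  -- the diamond and the BHK negative correlation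
  have hdia := diamond w o x y b
  -- numbers
  set D := μ.real (openConn x b : Set (BondConfig V))ᶜ with hD
  set Yc := μ.real (openConn y b : Set (BondConfig V))ᶜ with hYc
  set F := μ.real (openConn y b ∩ (openConn x b)ᶜ) with hF
  set G := μ.real (openConn x b ∩ (openConn y b)ᶜ) with hG
  set QF := μ.real (openConn o x ∩ openConn y b ∩ (openConn x b)ᶜ) with hQF
  set QG := μ.real (openConn o x ∩ openConn x b ∩ (openConn y b)ᶜ) with hQG
  set QD := μ.real (openConn o x ∩ (openConn x b)ᶜ) with hQD
  set QY := μ.real (openConn o x ∩ (openConn y b)ᶜ) with hQY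
  set Z := μ.real ((openConn x b : Set (BondConfig V))ᶜ ∩ (openConn y b)ᶜ) with hZ
  set z := μ.real (openConn o x ∩ (openConn x b)ᶜ ∩ (openConn y b)ᶜ) with hz
  -- bookkeeping identities
  have iD : D = Z + F := by
    have := split w ((openConn x b : Set (BondConfig V))ᶜ) ((openConn y b)ᶜ)
    rw [compl_compl] at this
    have e : ((openConn x b : Set (BondConfig V))ᶜ ∩ openConn y b) = openConn y b ∩ (openConn x b)ᶜ :=
      Set.inter_comm _ _
    rw [e] at this; linarith
  have iY : Yc = Z + G := by
    have := split w ((openConn y b : Set (BondConfig V))ᶜ) ((openConn x b)ᶜ)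
    rw [compl_compl] at this
    have e1 : ((openConn y b : Set (BondConfig V))ᶜ ∩ (openConn x b)ᶜ) = (openConn x b)ᶜ ∩ (openConn y b)ᶜ :=
      Set.inter_comm _ _
    have e2 : ((openConn y b : Set (BondConfig V))ᶜ ∩ openConn x b) = openConn x b ∩ (openConn y b)ᶜ :=
      Set.inter_comm _ _
    rw [e1, e2] at this; linarith
  have iQD : QD = z + QF := by
    have := split w (openConn o x ∩ (openConn x b)ᶜ) ((openConn y b)ᶜ)
    rw [compl_compl] at this
    have e : (openConn o x ∩ (openConn x b)ᶜ ∩ openConn y b : Set (BondConfig V)) =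
        openConn o x ∩ openConn y b ∩ (openConn x b)ᶜ := by
      ext ω; simp only [mem_inter_iff, mem_compl_iff]; tauto
    rw [e] at this; linarith
  have iQY : QY = z + QG := by
    have := split w (openConn o x ∩ (openConn y b)ᶜ) ((openConn x b)ᶜ)
    rw [compl_compl] at this
    have e1 : (openConn o x ∩ (openConn y b)ᶜ ∩ (openConn x b)ᶜ : Set (BondConfig V)) =
        openConn o x ∩ (openConn x b)ᶜ ∩ (openConn y b)ᶜ := by
      ext ω; simp only [mem_inter_iff, mem_compl_iff]; tauto
    have e2 : (openConn o x ∩ (openConn y b)ᶜ ∩ openConn x b : Set (BondConfig V)) =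
        openConn o x ∩ openConn x b ∩ (openConn y b)ᶜ := by
      ext ω; simp only [mem_inter_iff, mem_compl_iff]; tauto
    rw [e1, e2] at this; linarith
  have hGF : G ≤ F := by linarith
  -- BHK 2006, Thm 1.4 (clusters of `b` and `x` on `{b ↮ x}`):  D · QF ≤ F · QD
  have hN : D * QF ≤ F * QD := by
    by_cases hbx : b = x
    · have hD0 : D = 0 := by
        rw [hD, hbx]
        have : (openConn x x : Set (BondConfig V))ᶜ = ∅ := by
          ext ω; simp only [mem_compl_iff, openConn, mem_setOf_eq, mem_empty_iff_false, iff_false, not_not]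
          exact SimpleGraph.Reachable.refl x
        rw [this, measureReal_empty]
      rw [hD0, zero_mul]
      exact mul_nonneg measureReal_nonneg measureReal_nonneg
    have key := BHK2006_twoClusterConditionalAssociation_holds.openConn_negCorrelation V w b x y o hbx
    have s1 : (openConn b x : Set (BondConfig V)) = openConn x b := KNPreFKG.openConn_symm b x
    have s2 : (openConn b y : Set (BondConfig V)) = openConn y b := KNPreFKG.openConn_symm b y
    have s3 : (openConn x o : Set (BondConfig V)) = openConn o x := KNPreFKG.openConn_symm x o
    rw [s1, s2, s3] at key
    have e1 : ((openConn x b : Set (BondConfig V))ᶜ ∩ (openConn y b ∩ openConn o x)) =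
        openConn o x ∩ openConn y b ∩ (openConn x b)ᶜ := by
      ext ω; simp only [mem_inter_iff, mem_compl_iff]; tauto
    have e2 : ((openConn x b : Set (BondConfig V))ᶜ ∩ openConn y b) = openConn y b ∩ (openConn x b)ᶜ :=
      Set.inter_comm _ _
    have e3 : ((openConn x b : Set (BondConfig V))ᶜ ∩ openConn o x) = openConn o x ∩ (openConn x b)ᶜ :=
      Set.inter_comm _ _
    rw [e1, e2, e3] at key
    exact key
  -- assemble
  rw [iQD, iQY, iD, iY]
  have hZ0 : 0 ≤ Z := measureReal_nonneg
  have hz0 : 0 ≤ z := measureReal_nonneg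
  have hF0 : 0 ≤ F := measureReal_nonneg
  have hG0 : 0 ≤ G := measureReal_nonneg
  have hQF0 : 0 ≤ QF := measureReal_nonneg
  have hQG0 : 0 ≤ QG := measureReal_nonneg
  rw [iD, iQD] at hN
  -- goal: (z + QF) * (Z + G) ≤ (z + QG) * (Z + F)
  -- LHS'' := (Z+F) QF − (z+QF) F ≤ 0 (hN);  RHS'' := (Z+F) QG − (z+QF) G
  by_cases hcase : (z + QF) * G ≤ (Z + F) * QG
  · nlinarith [hN, hcase, mul_nonneg hz0 (sub_nonneg.2 hGF)]
  · push Not at hcase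
    -- here G > 0 and we use the diamond: QF * G ≤ QG * F
    have hGpos : 0 < G := by
      by_contra hG'
      have hG00 : G = 0 := le_antisymm (not_lt.1 hG') hG0
      rw [hG00, mul_zero] at hcase
      exact absurd hcase (not_lt.2 (mul_nonneg (add_nonneg hZ0 hF0) hQG0))
    -- G * [(Z+F)QF − (z+QF)F] ≤ F * [(Z+F)QG − (z+QF)G] ≤ G * [(Z+F)QG − (z+QF)G]
    have step1 : G * ((Z + F) * QF - (z + QF) * F) ≤ F * ((Z + F) * QG - (z + QF) * G) := by
      nlinarith [hdia, mul_nonneg (add_nonneg hZ0 hF0) hQF0]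
    have step2 : F * ((Z + F) * QG - (z + QF) * G) ≤ G * ((Z + F) * QG - (z + QF) * G) := by
      have hneg : (Z + F) * QG - (z + QF) * G < 0 := by linarith
      nlinarith [hGF, hneg]
    have step3 : (Z + F) * QF - (z + QF) * F ≤ (Z + F) * QG - (z + QF) * G :=
      le_of_mul_le_mul_left (step1.trans step2) hGpos
    nlinarith [step3]

/-- The complementary form: **`μ(o ↮ x | y ↮ b) ≤ μ(o ↮ x | x ↮ b)`** for `μ(y↮b) ≤ μ(x↮b)`, i.e.
`μ({o↮x}∩{y↮b}) · μ(x↮b) ≤ μ({o↮x}∩{x↮b}) · μ(y↮b)`. [this file] -/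
theorem ownDisconnection_compl [Fintype V] (w : Sym2 V → unitInterval) (o x y b : V)
    (hd : (prodBernoulli w).real (openConn y b : Set (BondConfig V))ᶜ ≤
      (prodBernoulli w).real (openConn x b : Set (BondConfig V))ᶜ) :
    (prodBernoulli w).real ((openConn o x)ᶜ ∩ (openConn y b)ᶜ) *
        (prodBernoulli w).real (openConn x b : Set (BondConfig V))ᶜ ≤
      (prodBernoulli w).real ((openConn o x)ᶜ ∩ (openConn x b)ᶜ) *
        (prodBernoulli w).real (openConn y b : Set (BondConfig V))ᶜ := by
  set μ := prodBernoulli w with hμ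
  have h := ownDisconnection_le w o x y b hd
  have e1 : μ.real ((openConn o x)ᶜ ∩ (openConn y b)ᶜ) =
      μ.real (openConn y b : Set (BondConfig V))ᶜ - μ.real (openConn o x ∩ (openConn y b)ᶜ) := by
    have := split w ((openConn y b : Set (BondConfig V))ᶜ) (openConn o x)
    rw [Set.inter_comm ((openConn y b)ᶜ) (openConn o x), Set.inter_comm ((openConn y b)ᶜ) ((openConn o x)ᶜ)] at this
    linarith
  have e2 : μ.real ((openConn o x)ᶜ ∩ (openConn x b)ᶜ) =
      μ.real (openConn x b : Set (BondConfig V))ᶜ - μ.real (openConn o x ∩ (openConn x b)ᶜ) := by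
    have := split w ((openConn x b : Set (BondConfig V))ᶜ) (openConn o x)
    rw [Set.inter_comm ((openConn x b)ᶜ) (openConn o x), Set.inter_comm ((openConn x b)ᶜ) ((openConn o x)ᶜ)] at this
    linarith
  rw [e1, e2]
  nlinarith [h]

end Summit.CriticalPhenomena.PercolationContinuityZ3.Theorems

end
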